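import Literature.MathematicalPhysics.QuantumFieldTheory.Balaban1983to89.B9Eq316AveragingTransposeZd

/-!
# `Balaban1983to89.B9Thm311GaugeReductionZd` — [Balaban1985BackgroundPropagators] Thm 3.11 p. 416, THE GAUGE STEP of its proof («Doing the gauge
# transformation we get the configuration U = e^{iηA} with A small») AS LATTICE KINEMATICS ON THE `ℤᵈ × 𝔸` CARRIER: a GAUGE-INVARIANT property of
# unitary backgrounds which holds on a UNIFORM BALL around the flat background and which READS the background only on the bonds of a box holds at
# EVERY unitary background whose plaquette variables are small on that box — two `clampCfg` cut-offs around the complete axial gauge of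
# [Balaban1985Averaging] p. 24 (`B7Prop1Explicit.axial_bond_bound`, BY NAME)

statement-level skeleton of published theorems with citation tags; proofs where landed; nothing here is a claim about the
Yang–Mills mass gap

`[Balaban1985BackgroundPropagators]` ("B9", CMP **99** (1985) 389–434) p. 416, proof of Thm 3.11: «Let us take G(U) and let us consider the
operators G_□(U). Doing the gauge transformation we get the configuration U = e^{iηA} with A small, and by (3.86) we get G_□(e^{iηA}) = G_□(1)(I −
V(A)G_□(1))⁻¹. In [4] we have proved that the operator G_□(1) is positive, hence by the same reasoning as above we prove positivity of G_□»; p. 396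
(3.34) «Δ_a(U^u) = R(u)Δ_a(U)R(u⁻¹), G(U^u) = R(u)G(U)R(u⁻¹)»; p. 398 «All these inequalities are invariant with respect to gauge transformations of
U».  `[Balaban1985Averaging]` ("B7" = B9's [5], CMP **98** (1985) 17–51) p. 24 l. −2 – p. 25 l. 2: the complete axial gauge `v₀(x) = V(Γ_{y,x})`,
«The conditions V₀(Γ_{y,x}) = 1 imply V₀(x, x + e₁) = 1, |V₀(x, x + e₂) − 1| < |x₁ − y₁|α₀, …» (the tree: `B7Prop1Explicit.axialFn`,
`axial_bond_bound`); p. 24 «this definition is local … depends only on the bond variables U_b for b ⊂ B^k(c₋) ∪ B^k(c₊)» (the tree's cut-off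
device `B7Prop1Local.clampCfg`, `pdev_clampCfg_le`).

CITATION HEADER (lean-in-tree rule).  Cell `pub-ymgap` (YM-PLAN Track A, HUMAN RULING D-0062), DAG node N06 = [B9], seat `pub-ymgap-dag-n06-b`
generation 19 (CLAIM-2 «IDEA-3.11 (iv)», cell bus 2026-08-28T05:34Z, no objection in the window; dag-n06-w3 g3 «(iv) is yours» l.29641).

WHY THIS FILE.  The per-member road to [B9] Theorem 3.11 at the `ℤᵈ × 𝔸` carrier (IDEA-3.11 of dag-n06-w2 g2) has landed (i) flat positivity
(this seat g18, `B9Thm311FlatHermKernelZd.flat_posDef_herm_cube`), (ii) the continuity engine «positive-definiteness is open in the background»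
(dag-n06-w4 g3, `B9Thm311PosDefOpenZd`) with the regime set containing a UNIFORM BALL around `U₀ = 1` (dag-n06-w2 g3 CLAIM-3), and (iii) gauge
covariance along orbits (dag-n06-w3 g3, `B9Eq334GaugeCovarianceZd[Herm]`).  What turns «regular on a uniform ball around every pure gauge» into
«regular at EVERY background of the member's small-field class» is print's gauge step, and it is pure lattice kinematics, independent of the
letters: THIS FILE proves it ONCE for an ARBITRARY property `P` of backgrounds.  HYPOTHESES on `P`: (B) `P` holds at every unitary background
uniformly `δ`-close to `1` on all of `ℤᵈ`; (G) `P` passes from `U^u` to `U` for unitary gauge functions `u`; (L) `P` reads the background only on the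
bonds of a box `[lo, hi]` (`AgreeOn lo hi U U′ ⟹ (P U ⟹ P U′)`).  CONCLUSION: `∃ α > 0`, every unitary `U₀` with `pdevOn lo hi U₀ < α` (plaquette
variables `α`-close to `1` on the plaquettes of the box) satisfies `P`.  MECHANISM (§2): `V := clampCfg lo hi U₀` agrees with `U₀` on the box and has
ALL its plaquettes small (`pdev_clampCfg_le`); the GLOBAL axial-gauge bound gives `‖V^{v₀}(x, μ) − 1‖ ≤ |x − lo|₁·α` with `v₀ = axialFn V lo` unitary;
`Ũ := clampCfg lo hi V^{v₀}` is UNIFORMLY `|hi − lo|₁·α`-close to `1` and agrees with `V^{v₀}` on the box; so (B) at `Ũ`, (L) to `V^{v₀}`, (G) to `V`,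
(L) to `U₀`.  §3 certifies that such `U₀` lie in print's regime (1.7) of the member when the box carries the member's plaquettes (so the genuine
averaging letter `QQZdP` is print's operator there, `B9Eq316AveragingTransposeZdPrinted.QQZdP_of_reg17`).  The knit at the cube member (`P :=
RegularAtH i.η (opsAllZd …) (i.Ω 0)`, (B) from dag-n06-w4∕w2, (G) from dag-n06-w3, (L) from this seat's locality file) follows in a separate file.

WHAT IS PROVED (kernel, 0 sorry, 0 def).
* §1 kinematics of the two cut-offs: (private `l1_clamp_sub_le`) · `norm_clampCfg_sub_one_le` · `gaugeAct_mem_of` · `axialFn_mem_of` ·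
  ★ `norm_axialGauge_clamp_sub_one_le` (`‖(V^{v₀})(x, μ) − 1‖ ≤ |x − lo|₁·α` for `V = clampCfg lo hi U₀`, `pdevOn lo hi U₀ ≤ α`, `U₀` unit-bounded).
* §2 ★★★ `of_pdevOn_lt` — THE GAUGE STEP: (B) + (G) + (L) ⟹ `∃ α > 0, ∀ unitary U₀, pdevOn lo hi U₀ < α → P U₀`, with the explicit
  `α = δ ∕ (|hi − lo|₁ + 1)` (`of_pdevOn_lt_explicit`).
* §3 ★ `reg17_of_pdevOn_lt` — small plaquettes on a box carrying every plaquette that touches `Ω_j` (`j ≤ m`) put a unit-bounded `U₀` in the class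
  (1.7) `Reg17 L m Ω α U₀` (window `α·L^{−2m}` on the box suffices).

HONEST SCOPE.  [folklore] lattice gauge kinematics (axial gauge + cut-off; textbook context: Creutz, *Quarks, Gluons and Lattices* ch. 9) arranged as
the gauge step of print's p. 416 proof; NO estimate of [B9]; the smallness `α` is per box (`δ∕(|hi − lo|₁ + 1)`), NOT print's uniform `α₀′`, `M₀` of
Thm 3.11, and the hypothesis is on the plaquettes of a BOX around the member, not literally the class `𝔄_m(α₀)` of (1.7)∕(3.35); count-neutral helper of
K1⁷ (`--supports stmt-QuantumFields-20542`); N05∕N06 NOT discharged; one finite `𝕋⁴` programme at fixed `ε`, Bałaban as printed; R4 closes only the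
conditional finite-`𝕋⁴` rung `BalabanLadder.UV` — nothing continuum ∕ `ℝ⁴` ∕ OS ∕ mass gap ∕ Clay.  Unit `pub-ymgap-dag-n06-b` (g19), 2026-08-28.
-/

noncomputable section

open scoped BigOperators

namespace Literature.MathematicalPhysics.QuantumFieldTheory.Balaban1983to89.B9Thm311GaugeReductionZd

open B7Prop1Explicit (U1 e l1 hol plaqWord gaugeAct axialFn axial_bond_bound)
open B7Prop1Local (InBox AgreeOn PlaqIn clamp clampCfg clamp_inBox clampCfg_agree clampCfg_mem pdevOn pdev_clampCfg_le le_pdevOn pdevOn_nonneg)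
open B7Prop2Explicit (pdev le_pdev unitaryUnits unitaryUnits_le_U1 hol_mem_of)
open B8Ineq132 (plaqF PlaqTouches)
open B9Eq316AveragingTransposeZd (Reg17)

-- `Site` alone could resolve to the torus sites of `Setup.lean`; re-export the `ℤ^d` sites of `B7Prop1Explicit`.
export B7Prop1Explicit (Site)

variable {d : ℕ} {𝔸 : Type*} [CStarAlgebra 𝔸] [Nontrivial 𝔸]

/-! ## §1 Kinematics of the two cut-offs around the complete axial gauge -/

section Kinematics

omit [Nontrivial 𝔸] in
/-- the projected point is at `ℓ¹`-distance at most `|hi − lo|₁` from the box's corner `lo`. [folklore] -/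
private theorem l1_clamp_sub_le {lo hi : Site d} (hlohi : ∀ i, lo i ≤ hi i) (x : Site d) : l1 (clamp lo hi x - lo) ≤ l1 (hi - lo) := by
  unfold l1
  refine Finset.sum_le_sum fun i _ => ?_
  have h := clamp_inBox hlohi x i
  have h1 : 0 ≤ clamp lo hi x i - lo i := by linarith [h.1]
  have h2 : clamp lo hi x i - lo i ≤ hi i - lo i := by linarith [h.2]
  simp only [Pi.sub_apply]
  omega

omit [Nontrivial 𝔸] in
/-- **THE OUTER CUT-OFF IS UNIFORMLY CLOSE TO `1`**: if `‖W(x, κ) − 1‖ ≤ c` at every site `x` of the box (`c ≥ 0`), then `clampCfg lo hi W` is `c`-close to `1`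
at EVERY bond of `ℤᵈ` (off the box it is `1` or a value of `W` read at a box site). [cite: Balaban1985Averaging, p.24 (locality)] -/
theorem norm_clampCfg_sub_one_le {lo hi : Site d} (hlohi : ∀ i, lo i ≤ hi i) {W : Site d → Fin d → 𝔸ˣ} {c : ℝ} (hc : 0 ≤ c)
    (hW : ∀ x, InBox lo hi x → ∀ κ, ‖((W x κ : 𝔸ˣ) : 𝔸) - 1‖ ≤ c) (x : Site d) (κ : Fin d) :
    ‖((clampCfg lo hi W x κ : 𝔸ˣ) : 𝔸) - 1‖ ≤ c := by
  unfold clampCfg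
  split_ifs
  · exact hW _ (clamp_inBox hlohi x) κ
  · rw [Units.val_one, sub_self, norm_zero]; exact hc

omit [CStarAlgebra 𝔸] [Nontrivial 𝔸] in
/-- a gauge transform by an `S`-valued gauge function keeps an `S`-valued configuration `S`-valued (`S` a subgroup). [cite: Balaban1985BackgroundPropagators, (3.28) p.395] -/
theorem gaugeAct_mem_of {G : Type*} [Group G] {S : Subgroup G} {V : Site d → Fin d → G} (hV : ∀ x κ, V x κ ∈ S) {u : Site d → G}
    (hu : ∀ x, u x ∈ S) (x : Site d) (κ : Fin d) : gaugeAct u V x κ ∈ S :=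
  S.mul_mem (S.mul_mem (hu x) (hV x κ)) (S.inv_mem (hu _))

omit [CStarAlgebra 𝔸] [Nontrivial 𝔸] in
/-- the complete axial gauge function of an `S`-valued configuration is `S`-valued (a parallel transport). [cite: Balaban1985Averaging, p.24 («v₀(x) = V(Γ_{y,x})»)] -/
theorem axialFn_mem_of {G : Type*} [Group G] {S : Subgroup G} {V : Site d → Fin d → G} (hV : ∀ x κ, V x κ ∈ S) (y x : Site d) :
    axialFn V y x ∈ S :=
  hol_mem_of hV _ _

/-- ★ **THE AXIAL GAUGE OF THE INNER CUT-OFF IS CLOSE TO `1` WITH LINEAR GROWTH**: for a unit-bounded `U₀` with `pdevOn lo hi U₀ ≤ α`, the configuration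
`V = clampCfg lo hi U₀` has ALL its plaquette variables `α`-close to `1` (`pdev_clampCfg_le`), so its complete axial gauge based at `lo` satisfies
`‖V^{v₀}(x, μ) − 1‖ ≤ |x − lo|₁·α` at EVERY bond ([5] p. 25 l. 1–2, `axial_bond_bound`). [cite: Balaban1985Averaging, p.24 l.-2–p.25 l.2, (44) p.24] -/
theorem norm_axialGauge_clamp_sub_one_le {lo hi : Site d} (hlohi : ∀ i, lo i ≤ hi i) {U₀ : Site d → Fin d → 𝔸ˣ}
    (hU₀ : ∀ x κ, U₀ x κ ∈ U1 𝔸) {α : ℝ} (hα : pdevOn lo hi U₀ ≤ α) (x : Site d) (μ : Fin d) :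
    ‖((gaugeAct (axialFn (clampCfg lo hi U₀) lo) (clampCfg lo hi U₀) x μ : 𝔸ˣ) : 𝔸) - 1‖ ≤ l1 (x - lo) * α := by
  have hV : ∀ x κ, clampCfg lo hi U₀ x κ ∈ U1 𝔸 := clampCfg_mem hU₀
  have hα0 : 0 ≤ α := (pdevOn_nonneg lo hi U₀).trans hα
  refine axial_bond_bound _ hV lo (fun z κ ν _ => ?_) hα0 x μ
  exact ((le_pdev hV z κ ν).trans (pdev_clampCfg_le hlohi hU₀)).trans hα

end Kinematics

/-! ## §2 The gauge step: uniform ball + orbit invariance + locality on a box ⟹ every background with small plaquettes on the box -/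

section GaugeStep

/-- ★★★ **THE GAUGE STEP OF [B9] THM 3.11's PROOF, AS A THEOREM SCHEMA WITH AN EXPLICIT THRESHOLD.**  Let `P` be a property of backgrounds such that
(B) `P U` for every unitary `U` with `‖U(b) − 1‖ < δ` at every bond of `ℤᵈ`; (G) `P (U^u) → P U` for unitary `U` and unitary gauge functions `u`;
(L) `P` reads the background on the bonds of the box `[lo, hi]` only.  Then every unitary `U₀` with `pdevOn lo hi U₀ < δ ∕ (|hi − lo|₁ + 1)` satisfies
`P` — print's «doing the gauge transformation we get the configuration U = e^{iηA} with A small» followed by «all these results are gauge invariant».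
[cite: Balaban1985BackgroundPropagators, Thm 3.11 p.416 (proof, the gauge transformation), (3.34) p.396, p.398 («invariant with respect to gauge transformations»); Balaban1985Averaging, p.24 l.-2–p.25 l.2] -/
theorem of_pdevOn_lt_explicit {P : (Site d → Fin d → 𝔸ˣ) → Prop} {lo hi : Site d} (hlohi : ∀ i, lo i ≤ hi i) {δ : ℝ} (hδ : 0 < δ)
    (hball : ∀ U : Site d → Fin d → 𝔸ˣ, (∀ x κ, U x κ ∈ unitaryUnits 𝔸) → (∀ x κ, ‖((U x κ : 𝔸ˣ) : 𝔸) - 1‖ < δ) → P U)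
    (hcov : ∀ (u : Site d → 𝔸ˣ) (U : Site d → Fin d → 𝔸ˣ), (∀ x, u x ∈ unitaryUnits 𝔸) → (∀ x κ, U x κ ∈ unitaryUnits 𝔸) →
      P (gaugeAct u U) → P U)
    (hloc : ∀ U U' : Site d → Fin d → 𝔸ˣ, (∀ x κ, U x κ ∈ unitaryUnits 𝔸) → (∀ x κ, U' x κ ∈ unitaryUnits 𝔸) →
      AgreeOn lo hi U U' → P U → P U')
    {U₀ : Site d → Fin d → 𝔸ˣ} (hU₀ : ∀ x κ, U₀ x κ ∈ unitaryUnits 𝔸) (hsmall : pdevOn lo hi U₀ < δ / (l1 (hi - lo) + 1)) : P U₀ := by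
  have hU₀1 : ∀ x κ, U₀ x κ ∈ U1 𝔸 := fun x κ => unitaryUnits_le_U1 (hU₀ x κ)
  -- the inner cut-off `V` and its complete axial gauge `W = V^{v₀}`
  have hV : ∀ x κ, clampCfg lo hi U₀ x κ ∈ unitaryUnits 𝔸 := clampCfg_mem hU₀
  have hv₀ : ∀ x, axialFn (clampCfg lo hi U₀) lo x ∈ unitaryUnits 𝔸 := fun x => axialFn_mem_of hV lo x
  have hW : ∀ x κ, gaugeAct (axialFn (clampCfg lo hi U₀) lo) (clampCfg lo hi U₀) x κ ∈ unitaryUnits 𝔸 := gaugeAct_mem_of hV hv₀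
  -- the outer cut-off `Ũ` is unitary and uniformly close to `1`
  have hD0 : (0 : ℝ) < (l1 (hi - lo) : ℝ) + 1 := by positivity
  have hα0 : 0 ≤ δ / (l1 (hi - lo) + 1) := by positivity
  have hbond : ∀ x, InBox lo hi x → ∀ κ,
      ‖((gaugeAct (axialFn (clampCfg lo hi U₀) lo) (clampCfg lo hi U₀) x κ : 𝔸ˣ) : 𝔸) - 1‖ ≤ l1 (hi - lo) * (δ / (l1 (hi - lo) + 1)) := by
    intro x hx κ
    refine (norm_axialGauge_clamp_sub_one_le hlohi hU₀1 hsmall.le x κ).trans ?_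
    have hx' : B7Prop1Local.clamp lo hi x = x := B7Prop1Local.clamp_of_inBox hx
    have hl : (l1 (x - lo) : ℝ) ≤ l1 (hi - lo) := by
      have h := l1_clamp_sub_le hlohi x
      rw [hx'] at h
      exact_mod_cast h
    exact mul_le_mul_of_nonneg_right hl hα0
  have hU : ∀ x κ, clampCfg lo hi (gaugeAct (axialFn (clampCfg lo hi U₀) lo) (clampCfg lo hi U₀)) x κ ∈ unitaryUnits 𝔸 :=
    clampCfg_mem hW
  have hUclose : ∀ x κ,
      ‖((clampCfg lo hi (gaugeAct (axialFn (clampCfg lo hi U₀) lo) (clampCfg lo hi U₀)) x κ : 𝔸ˣ) : 𝔸) - 1‖ < δ := by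
    intro x κ
    refine (norm_clampCfg_sub_one_le hlohi (by positivity) hbond x κ).trans_lt ?_
    rw [← mul_div_assoc, div_lt_iff₀ hD0]
    nlinarith
  -- (B) at `Ũ`, (L) to `W`, (G) to `V`, (L) to `U₀`
  have hPU : P (clampCfg lo hi (gaugeAct (axialFn (clampCfg lo hi U₀) lo) (clampCfg lo hi U₀))) := hball _ hU hUclose
  have hPW : P (gaugeAct (axialFn (clampCfg lo hi U₀) lo) (clampCfg lo hi U₀)) := hloc _ _ hU hW (clampCfg_agree _) hPU
  have hPV : P (clampCfg lo hi U₀) := hcov _ _ hv₀ hV hPW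
  exact hloc _ _ hV hU₀ (clampCfg_agree _) hPV

/-- ★★★ **THE GAUGE STEP, `∃ α` FORM**: under (B), (G), (L) there is `α > 0` (namely `δ ∕ (|hi − lo|₁ + 1)`) such that every unitary background whose plaquette
variables are `α`-close to `1` on the box satisfies `P`. [cite: Balaban1985BackgroundPropagators, Thm 3.11 p.416 (proof), (3.34) p.396, p.398; Balaban1985Averaging, p.24 l.-2–p.25 l.2] -/
theorem of_pdevOn_lt {P : (Site d → Fin d → 𝔸ˣ) → Prop} {lo hi : Site d} (hlohi : ∀ i, lo i ≤ hi i)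
    (hball : ∃ δ : ℝ, 0 < δ ∧ ∀ U : Site d → Fin d → 𝔸ˣ, (∀ x κ, U x κ ∈ unitaryUnits 𝔸) →
      (∀ x κ, ‖((U x κ : 𝔸ˣ) : 𝔸) - 1‖ < δ) → P U)
    (hcov : ∀ (u : Site d → 𝔸ˣ) (U : Site d → Fin d → 𝔸ˣ), (∀ x, u x ∈ unitaryUnits 𝔸) → (∀ x κ, U x κ ∈ unitaryUnits 𝔸) →
      P (gaugeAct u U) → P U)
    (hloc : ∀ U U' : Site d → Fin d → 𝔸ˣ, (∀ x κ, U x κ ∈ unitaryUnits 𝔸) → (∀ x κ, U' x κ ∈ unitaryUnits 𝔸) →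
      AgreeOn lo hi U U' → P U → P U') :
    ∃ α : ℝ, 0 < α ∧ ∀ U₀ : Site d → Fin d → 𝔸ˣ, (∀ x κ, U₀ x κ ∈ unitaryUnits 𝔸) → pdevOn lo hi U₀ < α → P U₀ := by
  obtain ⟨δ, hδ, hball⟩ := hball
  refine ⟨δ / (l1 (hi - lo) + 1), by positivity, fun U₀ hU₀ hsmall => ?_⟩
  exact of_pdevOn_lt_explicit hlohi hδ hball hcov hloc hU₀ hsmall

omit [Nontrivial 𝔸] in
/-- **(B) ⟹ the flat background has `P`** (sanity: the schema's ball hypothesis is about a neighbourhood of an inhabited point). [cite: Balaban1985BackgroundPropagators, Thm 3.11 p.416 («G_□(1) is positive»)] -/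
theorem one_of_ball {P : (Site d → Fin d → 𝔸ˣ) → Prop}
    (hball : ∃ δ : ℝ, 0 < δ ∧ ∀ U : Site d → Fin d → 𝔸ˣ, (∀ x κ, U x κ ∈ unitaryUnits 𝔸) →
      (∀ x κ, ‖((U x κ : 𝔸ˣ) : 𝔸) - 1‖ < δ) → P U) :
    P (1 : Site d → Fin d → 𝔸ˣ) := by
  obtain ⟨δ, hδ, h⟩ := hball
  refine h 1 (fun _ _ => ?_) (fun _ _ => by simpa using hδ)
  show ((1 : 𝔸ˣ) : 𝔸) ∈ unitary 𝔸
  rw [Units.val_one]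
  exact one_mem _

end GaugeStep

/-! ## §3 Small plaquettes on a box carrying the member's plaquettes put the background in print's class (1.7) -/

section Regime

/-- ★ **SMALL PLAQUETTES ON THE BOX ⟹ THE CLASS (1.7) OF THE MEMBER**: if every plaquette touching some `Ω_j` (`j ≤ m`) lies in the box `[lo, hi]`, then a
unit-bounded `U₀` with `pdevOn lo hi U₀ < α·(Lᵐ)⁻²` (`L ≥ 1`, `α ≥ 0`) satisfies `Reg17 L m Ω α U₀` — so the genuine averaging letter is print's operator
there (`QQZdP_of_reg17`). [cite: Balaban1985RegularSpaces, (1.7) p.77; Balaban1985BackgroundPropagators, (3.35) p.396] -/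
theorem reg17_of_pdevOn_lt {L : ℕ} (hL : 1 ≤ L) {m : ℕ} {Ω : ℕ → Set (Site d)} {lo hi : Site d}
    (hcarry : ∀ j, j ≤ m → ∀ (x : Site d) (μ ν : Fin d), μ ≠ ν → PlaqTouches (Ω j) x μ ν → PlaqIn lo hi (x, μ, ν))
    {U₀ : Site d → Fin d → 𝔸ˣ} (hU₀ : ∀ x κ, U₀ x κ ∈ U1 𝔸) {α : ℝ} (hα : 0 ≤ α)
    (hsmall : pdevOn lo hi U₀ < α * (((L : ℝ) ^ m)⁻¹) ^ 2) : Reg17 L m Ω α U₀ := by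
  intro j hj x μ ν hμν hp
  have hLr : (1 : ℝ) ≤ L := by exact_mod_cast hL
  have h1 := le_pdevOn hU₀ (hcarry j hj x μ ν hμν hp)
  have hmono : α * (((L : ℝ) ^ m)⁻¹) ^ 2 ≤ α * (((L : ℝ) ^ j)⁻¹) ^ 2 := by
    refine mul_le_mul_of_nonneg_left ?_ hα
    have hpow : (L : ℝ) ^ j ≤ (L : ℝ) ^ m := pow_le_pow_right₀ hLr hj
    have hj0 : (0 : ℝ) < (L : ℝ) ^ j := by positivity
    have hinv : ((L : ℝ) ^ m)⁻¹ ≤ ((L : ℝ) ^ j)⁻¹ := by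
      rw [inv_le_inv₀ (by positivity) hj0]; exact hpow
    exact pow_le_pow_left₀ (by positivity) hinv 2
  calc ‖plaqF U₀ μ ν x - 1‖ ≤ pdevOn lo hi U₀ := h1
    _ < α * (((L : ℝ) ^ m)⁻¹) ^ 2 := hsmall
    _ ≤ α * (((L : ℝ) ^ j)⁻¹) ^ 2 := hmono

/-- **the same for unitary backgrounds** (the junction's currency). [cite: Balaban1985RegularSpaces, (1.7) p.77] -/
theorem reg17_of_pdevOn_lt_unitary {L : ℕ} (hL : 1 ≤ L) {m : ℕ} {Ω : ℕ → Set (Site d)} {lo hi : Site d}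
    (hcarry : ∀ j, j ≤ m → ∀ (x : Site d) (μ ν : Fin d), μ ≠ ν → PlaqTouches (Ω j) x μ ν → PlaqIn lo hi (x, μ, ν))
    {U₀ : Site d → Fin d → 𝔸ˣ} (hU₀ : ∀ x κ, U₀ x κ ∈ unitaryUnits 𝔸) {α : ℝ} (hα : 0 ≤ α)
    (hsmall : pdevOn lo hi U₀ < α * (((L : ℝ) ^ m)⁻¹) ^ 2) : Reg17 L m Ω α U₀ :=
  reg17_of_pdevOn_lt hL hcarry (fun x κ => unitaryUnits_le_U1 (hU₀ x κ)) hα hsmall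

end Regime

end Literature.MathematicalPhysics.QuantumFieldTheory.Balaban1983to89.B9Thm311GaugeReductionZd

end
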